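import Summits.ResolutionOfSingularities.ResolutionOfSingularities.Theorems.EquisingularLiftEquisingularLiftNatTowerRuledRoots
import HarnessLib

/-!
# [OURS · L1 W4.5(b) · EL♮(3)] INPUT (e) «SECTION ISO» OF THE ROUND ROOT, ČECH / SECTION CASE: `DirLift.ruled_round_root` fed by `DirStepSec`

Crux chain w45b (cell `res-hironaka`, slot W4.5(b)), working crux **EL♮** = stmt-ResolutionOfSingularities-20038, child **EL♮(3)** =
stmt-ResolutionOfSingularities-20148, route EquisingularLift, line `sections`; registered stub `stub_elnat_coneTowerPointResolution` @ `ReachTower₃`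
(CHILD v20 b3765926fa2d2fc5). Written by res-L1-w45b-stub-4 g8 on res-L1-w45b-plan-1's AMENDMENT 2 (2026-08-27T20:06:25Z) / GO (20:14:38Z):
TOWER₃ assembly input (e) of res-L1-w45b-stub-2's `DirLift.ruled_round_root` (…NatTowerRuledRoots p562947; binder text of record
`L/res-L1-w45b-stub-2/ROOTS-INPUTS.sig.txt` 978abd3aff7daeaa). HONEST FRAMING: OURS; NOT a statement of any manuscript; AI-written, weaker than
expert review. No `sorry`; standard axioms; DEF-FREE; pure logic. `--supports stmt-ResolutionOfSingularities-20148 --as helper`.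

WHAT. Input (e) of the round root is the SECTION ISOMORPHISM `δ : Z̃ ⟶ Z̃₉` over `γ ≫ υ'` with `IsIso δ`. For a round ALONG A SECTION — the Čech
disjunct of lead-2's `TowerRound₂` (RULING-7, …NatTowerRoundTwoDefs p562650), and every direction round of `ReachDirZero₁` — this is LITERALLY the
registered downstairs clause `DirStepSec F₉ F₁₀ υ' Z₉ hZ₉ G γ Z hZ := ∃ δ, δ ≫ ι₉ = ι ≫ γ ≫ υ' ∧ IsIso δ` (…NatDirZeroDefs). So:
* `DirLift.ruled_round_root_of_dirStepSec` — `ruled_round_root` with `(hsec : DirStepSec …)` in place of `δ hδ [IsIso δ]` (the form res-D-pv-029's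
  round bricks and the S6 `hCech` supplier consume: they hold `hsec`, never a named `δ`);
* `towerFull_of_dirStepSec` — a section is a full (multi)section (`TowerFull`), the fact lead-2 proves inline in `reachTower₃_of_reachDirZero₁`,
  named for the assemblers.
The CONE disjunct of `TowerRound₂` (`TowerFull ∧ ConeWitness`, multisections admitted) does NOT yield `IsIso δ` from `Tower.Inv₂` (doubled-shadow
countermodel, STATUS 2026-08-27T20:22:51Z res-L1-w45b-stub-4): there (e) waits on the desk's ruling (registered text «all rounds along sections», after
which THIS lemma serves the cone brick too, or a transported birational-section side fact).

References (index only): res-L1-w45b-stub-2 …NatTowerRuledDefs p561677 / …NatTowerRuledRoots p562947; res-L1-w45b-lead-2 …NatDirZeroDefs,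
…NatTowerDefs, …NatTowerRoundTwoDefs p562650; res-D-pv-029 …NatTowerConeRound p558403 (the `hRuled` stand-in S2).
-/

set_option linter.dupNamespace false -- mandated namespace `Summit.<Summit>.<Problem>` of this single-conjunct summit

noncomputable section

open CategoryTheory CategoryTheory.Limits AlgebraicGeometry TopologicalSpace Topology IsLocalRing
open Literature.AlgebraicGeometry.Resolution
open Literature.AlgebraicGeometry.Morphisms (ProjCech.PP ProjCech.toSpec)
open AlgebraicGeometry.Scheme.IdealSheafData

namespace Summit.ResolutionOfSingularities.ResolutionOfSingularities.Cruxes.EquisingularLiftNat.Sections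

/-- **A section is a full (multi)section**: `DirStepSec ⇒ TowerFull` (an isomorphism is finite, flat and surjective). Named form of the inline
step of lead-2's `reachTower₃_of_reachDirZero₁`. [OURS · pure logic over …NatDirZeroDefs / …NatTowerDefs] -/
theorem towerFull_of_dirStepSec {F₉ F₁₀ : Scheme.{0}} {υ' : F₁₀ ⟶ F₉} {Z₉ : Set F₉} {hZ₉ : IsClosed Z₉}
    {G : Scheme.{0}} {γ : G ⟶ F₁₀} {Z : Set G} {hZ : IsClosed Z} (hsec : DirStepSec F₉ F₁₀ υ' Z₉ hZ₉ G γ Z hZ) :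
    TowerFull F₉ F₁₀ υ' Z₉ hZ₉ G γ Z hZ := by
  obtain ⟨δ, hδ, hiso⟩ := hsec
  exact ⟨δ, hδ, inferInstance, inferInstance, δ.surjective⟩

namespace DirLift

variable {O : Type} [CommRing O] {k : Type} [Field k] {θ : O →+* k} {P : Scheme.{0}} {q : P ⟶ Spec (.of O)} {Y : Set P}

/-- **Input (e) of the round root, section case: `DirLift.Ruled` is born at a round ALONG A SECTION** — res-L1-w45b-stub-2's
`DirLift.ruled_round_root` with the section isomorphism `δ : Z̃ ≅ Z̃₉` over `γ ≫ υ'` supplied by the registered downstairs clause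
`DirStepSec F₉ F₁₀ υ' Z₉ hZ₉ G γ Z hZ` (Čech disjunct of `TowerRound₂`; direction rounds). All other binders and the conclusion are VERBATIM
those of `ruled_round_root`. [OURS · pure logic] toward `stub_elnat_coneTowerPointResolution` / `stub_elnat_ratDirZeroPointResolution`
(stmt-ResolutionOfSingularities-20148 / -20038); NOT a statement of the manuscript. -/
theorem ruled_round_root_of_dirStepSec {F₉ : Scheme.{0}} {Z₉ : Set F₉} {hZ₉ : IsClosed Z₉} {F₁₀ : Scheme.{0}} {υ' : F₁₀ ⟶ F₉}
    {G G' : Scheme.{0}} (γ : G ⟶ F₁₀) (Z : Set G) (hZ : IsClosed Z) (υ₂ : G' ⟶ G) (hυ₂ : IsBlowup υ₂ (vanishingIdeal ⟨Z, hZ⟩))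
    (hsec : DirStepSec F₉ F₁₀ υ' Z₉ hZ₉ G γ Z hZ)
    (X : Scheme.{0}) (σ : X ⟶ P) (jG : G ⟶ X) (tG : G ⟶ Spec (.of k)) (𝒞 : X.IdealSheafData)
    (X'' : Scheme.{0}) (τ : X'' ⟶ X) (j₂ : G' ⟶ X'') (t₂ : G' ⟶ Spec (.of k))
    [IsIntegral X] [IsLocallyNoetherian X] (hXreg : Scheme.IsRegular X)
    (hsq : IsPullback jG tG (σ ≫ q) (Spec.map (CommRingCat.ofHom θ)))
    (hCZ : 𝒞.comap jG = vanishingIdeal ⟨Z, hZ⟩) (hCflat : Flat (𝒞.subschemeι ≫ σ ≫ q)) (hCreg : Scheme.IsRegular 𝒞.subscheme)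
    (hτ : IsBlowup τ 𝒞) (hsq₂ : IsPullback j₂ t₂ ((τ ≫ σ) ≫ q) (Spec.map (CommRingCat.ofHom θ))) (hcomm : j₂ ≫ τ = υ₂ ≫ jG)
    (hCoff : σ '' (𝒞.support : Set X) ⊆ {p : P | ¬ IsGenericPoint p Y})
    (hCframe : ∀ x ∈ 𝒞.support, ∃ c : Fin 2 → X.presheaf.stalk x, Ideal.span (Set.range c) = stalkIdeal 𝒞 x ∧ IsQuasiRegular c)
    (hCrat : RationalCarrier (redSub F₉ Z₉ hZ₉) →
      ∃ e₁ : 𝒞.subscheme ≅ ProjCech.PP O 1, e₁.hom ≫ ProjCech.toSpec O 1 = 𝒞.subschemeι ≫ σ ≫ q)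
    (E' : Set G') :
    Ruled O k θ P q Y F₉ Z₉ hZ₉ F₁₀ υ' G' (υ₂ ≫ γ) E' X'' (τ ≫ σ) j₂ (𝒞.comap τ) := by
  obtain ⟨δ, hδ, hiso⟩ := hsec
  exact ruled_round_root γ Z hZ υ₂ hυ₂ δ hδ X σ jG tG 𝒞 X'' τ j₂ t₂ hXreg hsq hCZ hCflat hCreg hτ hsq₂ hcomm hCoff hCframe hCrat E'

/-- **The same, in res-D-pv-029's cone-brick binder order with the centre spelled `𝓔 ⊔ 𝒦`** (the shape of the stand-in `hRuled` of
`Tower.inv₂_coneRound_new`, …NatTowerConeRound, PLUS the inputs it lacks: `hυ₂`, the section clause `hsec`, `hCoff`, `hCframe`, `hCrat`):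
usable verbatim by a cone brick once its round carries `DirStepSec` (desk ruling pending, see the module docstring). [OURS · pure logic] -/
theorem ruled_coneRound_root_of_dirStepSec {F₉ : Scheme.{0}} {Z₉ : Set F₉} {hZ₉ : IsClosed Z₉} {F₁₀ : Scheme.{0}} {υ' : F₁₀ ⟶ F₉}
    (G G' : Scheme.{0}) (γ : G ⟶ F₁₀) (T : Set G) (Z : Set G) (hZ : IsClosed Z) (υ₂ : G' ⟶ G)
    (X : Scheme.{0}) (σ : X ⟶ P) (S : Set X) (jG : G ⟶ X) (tG : G ⟶ Spec (.of k)) (𝓔 𝒦 : X.IdealSheafData)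
    (X'' : Scheme.{0}) (τ : X'' ⟶ X) (j₂ : G' ⟶ X'') (t₂ : G' ⟶ Spec (.of k))
    [IsIntegral X] [IsLocallyNoetherian X] (hXreg : Scheme.IsRegular X)
    (hsq : IsPullback jG tG (σ ≫ q) (Spec.map (CommRingCat.ofHom θ))) (_hTS : jG '' T = S)
    (hCZ : (𝓔 ⊔ 𝒦).comap jG = vanishingIdeal ⟨Z, hZ⟩) (hCflat : Flat ((𝓔 ⊔ 𝒦).subschemeι ≫ σ ≫ q))
    (hCreg : Scheme.IsRegular (𝓔 ⊔ 𝒦).subscheme) (hτ : IsBlowup τ (𝓔 ⊔ 𝒦))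
    (hsq₂ : IsPullback j₂ t₂ ((τ ≫ σ) ≫ q) (Spec.map (CommRingCat.ofHom θ))) (hcomm : j₂ ≫ τ = υ₂ ≫ jG)
    -- the inputs the stand-in lacks
    (hυ₂ : IsBlowup υ₂ (vanishingIdeal ⟨Z, hZ⟩)) (hsec : DirStepSec F₉ F₁₀ υ' Z₉ hZ₉ G γ Z hZ)
    (hCoff : σ '' ((𝓔 ⊔ 𝒦).support : Set X) ⊆ {p : P | ¬ IsGenericPoint p Y})
    (hCframe : ∀ x ∈ (𝓔 ⊔ 𝒦).support, ∃ c : Fin 2 → X.presheaf.stalk x,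
      Ideal.span (Set.range c) = stalkIdeal (𝓔 ⊔ 𝒦) x ∧ IsQuasiRegular c)
    (hCrat : RationalCarrier (redSub F₉ Z₉ hZ₉) →
      ∃ e₁ : (𝓔 ⊔ 𝒦).subscheme ≅ ProjCech.PP O 1, e₁.hom ≫ ProjCech.toSpec O 1 = (𝓔 ⊔ 𝒦).subschemeι ≫ σ ≫ q) :
    Ruled O k θ P q Y F₉ Z₉ hZ₉ F₁₀ υ' G' (υ₂ ≫ γ) (υ₂ ⁻¹' Z) X'' (τ ≫ σ) j₂ ((𝓔 ⊔ 𝒦).comap τ) :=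
  ruled_round_root_of_dirStepSec γ Z hZ υ₂ hυ₂ hsec X σ jG tG (𝓔 ⊔ 𝒦) X'' τ j₂ t₂ hXreg hsq hCZ hCflat hCreg hτ hsq₂ hcomm hCoff
    hCframe hCrat _

/-- **E1-legality of a sup-centre from its exceptional component** (input (b) at a cone round, the one-liner res-D-pv-029 uses inline:
`supp (𝓔 ⊔ 𝒦) ⊆ supp 𝓔`). [OURS · pure logic] -/
theorem image_support_sup_subset_of_left {X : Scheme.{0}} (σ : X ⟶ P) (𝓔 𝒦 : X.IdealSheafData) (N : Set P)
    (h : σ '' (𝓔.support : Set X) ⊆ N) : σ '' ((𝓔 ⊔ 𝒦).support : Set X) ⊆ N := by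
  rintro _ ⟨x, hx, rfl⟩
  exact h ⟨x, Scheme.IdealSheafData.support_antitone le_sup_left hx, rfl⟩

end DirLift

end Summit.ResolutionOfSingularities.ResolutionOfSingularities.Cruxes.EquisingularLiftNat.Sections

end
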